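import Mathlib
import HarnessLib

/-!
# QUANT lane R8, T-DEC: the U-RPM identity — arm-1 g52's heavy-single root-pattern mixture (ARCH-G52 §3.2) has CLOSED-FORM
# inclusion–exclusion weights for EVERY width; the algebra is a Hurwitz-type multinomial Abel identity (census-1 gen 25)

builds on p205010 (kernel theorem, internal audit signed; external expert review pending)

Support file (`--supports stmt-CriticalPhenomena-4575`), QUANT lane seat prim-quant-census-1 (gen 25); memo
`run/shared/lean/prim/quant/prim-quant-census-1/g25/URPM-G25.md`.  Self-contained real algebra over finite sets (no law machinery);
small `def`s naming the sums, theorems with standard axioms, no sorries.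

SETTING (prim-quant-arm-1 g52, ARCH-G52 §3.2: heavy-single orientation of the residual recursion ✓ p486817/p487332/p487604).  A heavy
sibling with gate `q₁` faces the compound of the siblings `t ∈ R` (`r = |R|`, gates `q_t = q₁ l_t`, sub-forest means `m_t`); the opened
compound has root-pattern law `ν(A) = q₁^{|A|-1} Π_{t∈A} l_t Π_{t∉A}(1 − q₁ l_t)` (`A ≠ ∅`), `ν(∅) = (Π_t(1 − q₁ l_t) − (1 − q₁))/q₁`.  With
mass shares `c_t = q_t m_t/Σ_s q_s m_s` (`Σ c = 1`), `s_E = Σ_{t∈E} c_t`, the oracle-legal components are the PROPORTIONAL PRODUCTS on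
`∅ ≠ E ⊆ R` (open `t ∈ E` independently with probability `l_t/s_E`; all of mean `m*`).  ARCH-G52 conjectured (exact inclusion–exclusion,
261 instances, widths 2–5) that a nonnegative mixture of them reproduces `ν` iff `m* ≤ min m_t`.  HERE: the inclusion–exclusion weights are
`w_E = q₁^{|E|-1}(1 − q₁)·s_E^{|E|}·(1 − q₁ s_E)^{r-|E|-1}` (`E ≠ R`), `w_R = q₁^{r-1}` — manifestly `≥ 0` — and the mixture identity holds
for every pattern, as the specialisation `z = q₁`, `K = R∖A`, `α = s_A` of
(★) `hurwitz_gen`: for a finite `K`, reals `z, α, (a_t), (l_t)`, `s_G := α + Σ_{t∈G} a_t`: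
  `Σ_{G ⊊ K} (1 − z s_K)·z^{|G|}(1 − z s_G)^{|K|-|G|-1} Π_{t∈G}(s_G − l_t) + z^{|K|} Π_{t∈K}(s_K − l_t) = Π_{t∈K}(1 − z l_t)`
(`l ≡ 0`: Hurwitz's multinomial Abel identity `Σ_G (x + a(G))^{|G|}·y·(y + a(K∖G))^{|K∖G|-1} = (x + y + a(K))^{|K|}`).  PROOF: the
polynomial `V^{(e)}_K(β) = Σ_{G⊆K} z^{|G|}(1 − z(β + a(G)))^{|K|-|G|+e} Π_{t∈G}(β + a(G) − l_t)` has degree `≤ e` in `β` — induction on `K` via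
`V^{(e)}_{K+v} = V^{(e+1)}_K − V^{(e+1)}_K(· + a_v) + (1 − z l_v)·V^{(e)}_K(· + a_v)` — so `V_K := V^{(0)}_K` is CONSTANT (`Vr_const`); hence
`U_{K+v}(α) = (1 − z l_v)·U_K(α + a_v)` for the left side `U_K = (1 − z s_K)·F_K + z s_K·top_K` of (★), and `U_∅ = 1`.
DECLS: `Vp`, `Vp_insert`, `natDegree_Vp_le`, `Vr`, `Vr_const` (degree argument); `Fr`, `topr`, `Ur`, `Fr_insert`, `Ur_insert`,
**`Ur_eq_prod`**, **`hurwitz_gen`** ((★)); **`urpm_pattern`** (every nonempty pattern `A`; components `E = A ∪ G`, `G ⊆ R∖A`; division-free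
summands `ŵ_E·Π_{t∈A} l_t·Π_{t∈G}(s_E − l_t)`, `ŵ_E = w_E/s_E^{|E|}` = `urpmWr`), **`urpm_empty`** (`q₁·Σ_{E≠∅} ŵ_E Π_{t∈E}(s_E − l_t) =
Π(1 − q₁ l_t) − (1 − q₁)`), **`urpm_total`** (`Σ_{E≠∅} w_E = 1`), `urpmW_nonneg`, `urpm_box` (`l_t/s_E ≤ 1` from `l_t ≤ c_t`, i.e. `m* ≤ m_t`).
HONEST STATUS: pure algebra — the certificate ARCH-G52 §3.2 asks for, every width; the law-level assembly (pattern mixture ⟹ mixture of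
forest laws ⟹ width-`k` heavy-single balanced sibling step from the induction hypothesis, as ✓ p485371/p485785 for width 3) is NOT here;
`LightResidDECOracle`, `SiblingStep`, `GateStepN`, `FarTreeRow` OPEN; RATE class log\* / honest sentence of `run/shared/lean/prim/quant/README.md`
unchanged.  [this work]; conjecture + setting: prim-quant-arm-1 g52.  Prior art (`l ≡ 0`): A. Hurwitz, Acta Math. 26 (1902); D. E. Knuth, Selected
Papers on Discrete Mathematics (2001) p. 212 (1); J. Pitman, JCTA 98 (2002) — searched 2026-08-27 (corpus + galaxy), the `Π(s_G − l_t)` form not found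
as printed; nothing here is cited as a published result.  Rows served [cite: KozmaNitzan2024, Conjecture 3 (p. 15)]; [cite: Grimmett1999, §1.3 p. 10].
-/

noncomputable section

open Polynomial Finset
open scoped BigOperators

namespace Summit.CriticalPhenomena.PercolationContinuityZ3.Theorems
namespace Quant
namespace URPM

variable {ι : Type*}

/-! ### §1 The degree argument -/

/-- subset sum `a(G) = Σ_{t∈G} a_t`. [this work] -/
def asum (a : ι → ℝ) (G : Finset ι) : ℝ := ∑ t ∈ G, a t

/-- `a(G + v) = a_v + a(G)`. [this work] -/
theorem asum_insert [DecidableEq ι] (a : ι → ℝ) {v : ι} {G : Finset ι} (h : v ∉ G) : asum a (insert v G) = a v + asum a G :=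
  Finset.sum_insert h

/-- `α + a(G + v) = (α + a_v) + a(G)` (the shape produced by shifting `α`). [this work] -/
theorem add_asum_insert [DecidableEq ι] (a : ι → ℝ) {v : ι} {G : Finset ι} (h : v ∉ G) (α : ℝ) :
    α + asum a (insert v G) = α + a v + asum a G := by
  rw [asum_insert a h, add_assoc]

/-- the summand of `V^{(e)}` at `G` for a set of size `n`, as a polynomial in `β`:
`z^{|G|}·(1 − z(β + a(G)))^{n-|G|+e}·Π_{t∈G}(β + a(G) − l_t)`. [this work] -/
def vterm (z : ℝ) (a l : ι → ℝ) (n e : ℕ) (G : Finset ι) : ℝ[X] :=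
  C (z ^ G.card) * (1 - C z * (X + C (asum a G))) ^ (n - G.card + e) * ∏ t ∈ G, (X + C (asum a G - l t))

/-- `V^{(e)}_K(β) = Σ_{G⊆K} z^{|G|}(1 − z(β + a(G)))^{|K|-|G|+e} Π_{t∈G}(β + a(G) − l_t)`, as a polynomial in `β`. [this work] -/
def Vp (z : ℝ) (a l : ι → ℝ) (K : Finset ι) (e : ℕ) : ℝ[X] :=
  ∑ G ∈ K.powerset, vterm z a l K.card e G

/-- shifting a linear factor. [this work] -/
theorem comp_shift_lin (s d : ℝ) : (X + C s : ℝ[X]).comp (X + C d) = X + C (d + s) := by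
  rw [add_comp, X_comp, C_comp, map_add]; ring

/-- shifting the `(1 − z(β + s))` factor. [this work] -/
theorem comp_shift_P (z s d : ℝ) : (1 - C z * (X + C s) : ℝ[X]).comp (X + C d) = 1 - C z * (X + C (d + s)) := by
  rw [sub_comp, one_comp, mul_comp, C_comp, comp_shift_lin]

/-- shifting a summand by `d`. [this work] -/
theorem vterm_comp (z : ℝ) (a l : ι → ℝ) (n e : ℕ) (G : Finset ι) (d : ℝ) :
    (vterm z a l n e G).comp (X + C d) =
      C (z ^ G.card) * (1 - C z * (X + C (d + asum a G))) ^ (n - G.card + e) * ∏ t ∈ G, (X + C (d + asum a G - l t)) := by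
  unfold vterm
  rw [mul_comp, mul_comp, C_comp, pow_comp, comp_shift_P, Polynomial.prod_comp]
  congr 1
  refine Finset.prod_congr rfl fun t _ => ?_
  rw [comp_shift_lin, add_sub]

/-- **the recurrence** `V^{(e)}_{K+v} = V^{(e+1)}_K − V^{(e+1)}_K(· + a_v) + (1 − z l_v)·V^{(e)}_K(· + a_v)`. [this work] -/
theorem Vp_insert [DecidableEq ι] (z : ℝ) (a l : ι → ℝ) (K : Finset ι) {v : ι} (hv : v ∉ K) (e : ℕ) :
    Vp z a l (insert v K) e = Vp z a l K (e + 1) - (Vp z a l K (e + 1)).comp (X + C (a v)) +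
      C (1 - z * l v) * (Vp z a l K e).comp (X + C (a v)) := by
  unfold Vp
  rw [Finset.sum_powerset_insert hv, Finset.card_insert_of_notMem hv, Polynomial.sum_comp, Polynomial.sum_comp,
    Finset.mul_sum]
  have h1 : ∑ G ∈ K.powerset, vterm z a l (K.card + 1) e G = ∑ G ∈ K.powerset, vterm z a l K.card (e + 1) G := by
    refine Finset.sum_congr rfl fun G hG => ?_
    have hc : G.card ≤ K.card := Finset.card_le_card (Finset.mem_powerset.1 hG)
    unfold vterm
    rw [show K.card + 1 - G.card + e = K.card - G.card + (e + 1) by omega]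
  have h2 : ∑ G ∈ K.powerset, vterm z a l (K.card + 1) e (insert v G) =
      ∑ G ∈ K.powerset, (C (1 - z * l v) * (vterm z a l K.card e G).comp (X + C (a v)) -
        (vterm z a l K.card (e + 1) G).comp (X + C (a v))) := by
    refine Finset.sum_congr rfl fun G hG => ?_
    have hGK : G ⊆ K := Finset.mem_powerset.1 hG
    have hvG : v ∉ G := fun h => hv (hGK h)
    rw [vterm_comp, vterm_comp]
    unfold vterm
    have eW : C (1 - z * l v) = 1 - C z * C (l v) := by rw [map_sub, map_one, map_mul]
    rw [Finset.card_insert_of_notMem hvG, asum_insert a hvG, Finset.prod_insert hvG, Nat.add_sub_add_right,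
      show K.card - G.card + (e + 1) = K.card - G.card + e + 1 by omega, pow_succ, pow_succ, map_mul, map_sub, eW]
    ring
  rw [h1, h2, Finset.sum_sub_distrib]
  ring

/-- shifting does not raise the degree, and the difference with the shift drops it. [this work] -/
theorem natDegree_sub_comp_le (p : ℝ[X]) (d : ℝ) (e : ℕ) (hp : p.natDegree ≤ e + 1) :
    (p - p.comp (X + C d)).natDegree ≤ e := by
  by_cases h0 : p.natDegree = 0
  · rw [eq_C_of_natDegree_eq_zero h0, C_comp, sub_self, natDegree_zero]
    exact Nat.zero_le _
  · have hq1 : (X + C d : ℝ[X]).natDegree = 1 := natDegree_X_add_C d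
    have hdeg : (p.comp (X + C d)).natDegree = p.natDegree := by rw [natDegree_comp, hq1, mul_one]
    have hlc : (p.comp (X + C d)).leadingCoeff = p.leadingCoeff := by
      rw [leadingCoeff_comp (by rw [hq1]; exact one_ne_zero), leadingCoeff_X_add_C, one_pow, mul_one]
    have hp0 : p ≠ 0 := fun h => h0 (by rw [h, natDegree_zero])
    have hc0 : p.comp (X + C d) ≠ 0 := fun h => by
      rw [h, natDegree_zero] at hdeg
      exact h0 hdeg.symm
    by_cases hs : p - p.comp (X + C d) = 0
    · rw [hs, natDegree_zero]; exact Nat.zero_le _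
    · have hlt : (p - p.comp (X + C d)).degree < p.degree :=
        degree_sub_lt (by rw [degree_eq_natDegree hp0, degree_eq_natDegree hc0, hdeg]) hp0 hlc.symm
      have := natDegree_lt_natDegree hs hlt
      omega

/-- **`deg_β V^{(e)}_K ≤ e`.** [this work] -/
theorem natDegree_Vp_le [DecidableEq ι] (z : ℝ) (a l : ι → ℝ) (K : Finset ι) : ∀ e : ℕ, (Vp z a l K e).natDegree ≤ e := by
  induction K using Finset.induction_on with
  | empty =>
    intro e
    have h1 : (1 - C z * (X + C (asum a ∅)) : ℝ[X]).natDegree ≤ 1 :=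
      (natDegree_sub_le _ _).trans (max_le (by simp) ((natDegree_C_mul_le _ _).trans (by rw [natDegree_X_add_C])))
    simpa [Vp, vterm] using natDegree_pow_le.trans (Nat.mul_le_mul_left e h1)
  | insert v K hv ih =>
    intro e
    rw [Vp_insert z a l K hv e]
    refine (natDegree_add_le _ _).trans (max_le (natDegree_sub_comp_le _ _ e (ih (e + 1))) ?_)
    refine (natDegree_C_mul_le _ _).trans ?_
    rw [natDegree_comp, natDegree_X_add_C, mul_one]
    exact ih e

/-- `V_K(β) = Σ_{G⊆K} z^{|G|}(1 − z(β + a(G)))^{|K|-|G|} Π_{t∈G}(β + a(G) − l_t)` (real-valued). [this work] -/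
def Vr (z : ℝ) (a l : ι → ℝ) (K : Finset ι) (β : ℝ) : ℝ :=
  ∑ G ∈ K.powerset, z ^ G.card * (1 - z * (β + asum a G)) ^ (K.card - G.card) * ∏ t ∈ G, (β + asum a G - l t)

/-- `V_K(β)` is the evaluation of `V^{(0)}_K` at `β`. [this work] -/
theorem Vr_eq_eval (z : ℝ) (a l : ι → ℝ) (K : Finset ι) (β : ℝ) : Vr z a l K β = (Vp z a l K 0).eval β := by
  simp [Vr, Vp, vterm, eval_finsetSum, eval_prod, add_sub]

/-- **`V_K` DOES NOT DEPEND ON `β`** (the constancy lemma of URPM-G25 §3). [this work] -/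
theorem Vr_const [DecidableEq ι] (z : ℝ) (a l : ι → ℝ) (K : Finset ι) (β β' : ℝ) : Vr z a l K β = Vr z a l K β' := by
  have hC := eq_C_of_natDegree_le_zero (natDegree_Vp_le z a l K 0)
  rw [Vr_eq_eval, Vr_eq_eval, hC, eval_C, eval_C]

/-! ### §2 The Hurwitz-type identity (★) -/

/-- `F_K(α) = Σ_{G⊆K} z^{|G|}(1 − z s_G)^{|K|-|G|-1} Π_{t∈G}(s_G − l_t)`, `s_G = α + a(G)` (truncated exponent: the `G = K` term
is `z^{|K|} Π_{t∈K}(s_K − l_t)`). [this work] -/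
def Fr (z : ℝ) (a l : ι → ℝ) (K : Finset ι) (α : ℝ) : ℝ :=
  ∑ G ∈ K.powerset, z ^ G.card * (1 - z * (α + asum a G)) ^ (K.card - G.card - 1) * ∏ t ∈ G, (α + asum a G - l t)

/-- the top term `z^{|K|} Π_{t∈K}(s_K − l_t)`. [this work] -/
def topr (z : ℝ) (a l : ι → ℝ) (K : Finset ι) (α : ℝ) : ℝ :=
  z ^ K.card * ∏ t ∈ K, (α + asum a K - l t)

/-- `U_K(α) = (1 − z s_K)·F_K(α) + z s_K·top_K(α)` — the left side of (★). [this work] -/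
def Ur (z : ℝ) (a l : ι → ℝ) (K : Finset ι) (α : ℝ) : ℝ :=
  (1 - z * (α + asum a K)) * Fr z a l K α + z * (α + asum a K) * topr z a l K α

/-- splitting `F_{K+v}` over `G ∌ v` / `G ∋ v`. [this work] -/
theorem Fr_insert [DecidableEq ι] (z : ℝ) (a l : ι → ℝ) (K : Finset ι) {v : ι} (hv : v ∉ K) (α : ℝ) :
    Fr z a l (insert v K) α = Vr z a l K α + (1 - z * l v) * Fr z a l K (α + a v) - Vr z a l K (α + a v) +
      z * (α + a v + asum a K) * topr z a l K (α + a v) := by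
  conv_lhs => unfold Fr
  rw [Finset.sum_powerset_insert hv, Finset.card_insert_of_notMem hv]
  have h1 : ∑ G ∈ K.powerset, z ^ G.card * (1 - z * (α + asum a G)) ^ (K.card + 1 - G.card - 1) *
      ∏ t ∈ G, (α + asum a G - l t) = Vr z a l K α := by
    unfold Vr
    refine Finset.sum_congr rfl fun G _ => ?_
    rw [show K.card + 1 - G.card - 1 = K.card - G.card by omega]
  -- the `G ∋ v` part, termwise against `(1 − z l_v)·F_K(α + a_v) − V_K(α + a_v)`; the defect sits at `G = K` only
  have h2 : ∑ G ∈ K.powerset, z ^ (insert v G).card * (1 - z * (α + asum a (insert v G))) ^ (K.card + 1 - (insert v G).card - 1) *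
      ∏ t ∈ insert v G, (α + asum a (insert v G) - l t) =
      (1 - z * l v) * Fr z a l K (α + a v) - Vr z a l K (α + a v) + z * (α + a v + asum a K) * topr z a l K (α + a v) := by
    have hD : ∑ G ∈ K.powerset, (z ^ (insert v G).card * (1 - z * (α + asum a (insert v G))) ^ (K.card + 1 - (insert v G).card - 1) *
        ∏ t ∈ insert v G, (α + asum a (insert v G) - l t) -
        ((1 - z * l v) * (z ^ G.card * (1 - z * (α + a v + asum a G)) ^ (K.card - G.card - 1) * ∏ t ∈ G, (α + a v + asum a G - l t)) -
          z ^ G.card * (1 - z * (α + a v + asum a G)) ^ (K.card - G.card) * ∏ t ∈ G, (α + a v + asum a G - l t))) =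
        z * (α + a v + asum a K) * topr z a l K (α + a v) := by
      rw [Finset.sum_eq_single_of_mem K (Finset.mem_powerset_self K)]
      · unfold topr
        rw [Finset.card_insert_of_notMem hv, add_asum_insert a hv, Finset.prod_insert hv]
        simp only [Nat.sub_self, Nat.zero_sub, pow_zero, pow_succ]
        ring
      · intro G hG hne
        have hGK : G ⊆ K := Finset.mem_powerset.1 hG
        have hvG : v ∉ G := fun h => hv (hGK h)
        have hlt : G.card < K.card := Finset.card_lt_card (lt_of_le_of_ne hGK hne)
        obtain ⟨m, hm⟩ : ∃ m, K.card - G.card = m + 1 := ⟨K.card - G.card - 1, by omega⟩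
        rw [Finset.card_insert_of_notMem hvG, add_asum_insert a hvG, Finset.prod_insert hvG,
          show K.card + 1 - (G.card + 1) - 1 = m by omega, hm, Nat.add_sub_cancel, pow_succ, pow_succ]
        ring
    rw [Finset.sum_sub_distrib, sub_eq_iff_eq_add] at hD
    rw [hD]
    unfold Fr Vr
    rw [Finset.sum_sub_distrib, Finset.mul_sum]
    ring
  rw [h1, h2]
  ring

/-- the top term splits off its `v`-factor. [this work] -/
theorem topr_insert [DecidableEq ι] (z : ℝ) (a l : ι → ℝ) (K : Finset ι) {v : ι} (hv : v ∉ K) (α : ℝ) :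
    topr z a l (insert v K) α = z * (α + a v + asum a K - l v) * topr z a l K (α + a v) := by
  unfold topr
  rw [Finset.card_insert_of_notMem hv, add_asum_insert a hv, Finset.prod_insert hv, pow_succ]
  ring

/-- **the recurrence `U_{K+v}(α) = (1 − z l_v)·U_K(α + a_v)`** (uses the constancy of `V_K`). [this work] -/
theorem Ur_insert [DecidableEq ι] (z : ℝ) (a l : ι → ℝ) (K : Finset ι) {v : ι} (hv : v ∉ K) (α : ℝ) :
    Ur z a l (insert v K) α = (1 - z * l v) * Ur z a l K (α + a v) := by
  unfold Ur
  rw [Fr_insert z a l K hv, topr_insert z a l K hv, asum_insert a hv, Vr_const z a l K α (α + a v)]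
  ring

/-- `U_∅ = 1`. [this work] -/
theorem Ur_empty (z : ℝ) (a l : ι → ℝ) (α : ℝ) : Ur z a l ∅ α = 1 := by
  unfold Ur Fr topr
  simp only [Finset.powerset_empty, Finset.sum_singleton, Finset.card_empty, Finset.prod_empty, asum, Finset.sum_empty,
    pow_zero, Nat.zero_sub, mul_one, add_zero]
  ring

/-- **`U_K(α) = Π_{t∈K}(1 − z l_t)`** for every finite `K` and every `α`. [this work] -/
theorem Ur_eq_prod [DecidableEq ι] (z : ℝ) (a l : ι → ℝ) (K : Finset ι) : ∀ α : ℝ, Ur z a l K α = ∏ t ∈ K, (1 - z * l t) := by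
  induction K using Finset.induction_on with
  | empty => intro α; rw [Ur_empty, Finset.prod_empty]
  | insert v K hv ih => intro α; rw [Ur_insert z a l K hv, ih, Finset.prod_insert hv]

/-- **(★) THE HURWITZ-TYPE IDENTITY.**  For a finite set `K`, reals `z, α, (a_t), (l_t)` and `s_G := α + Σ_{t∈G} a_t`:
`Σ_{G ⊊ K} (1 − z s_K)·(z^{|G|} (1 − z s_G)^{|K|-|G|-1} Π_{t∈G}(s_G − l_t)) + z^{|K|} Π_{t∈K}(s_K − l_t) = Π_{t∈K}(1 − z l_t)`.
(`l ≡ 0`: Hurwitz 1902.) [this work] -/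
theorem hurwitz_gen [DecidableEq ι] (z : ℝ) (a l : ι → ℝ) (K : Finset ι) (α : ℝ) :
    ∑ G ∈ K.powerset.erase K, (1 - z * (α + asum a K)) *
        (z ^ G.card * (1 - z * (α + asum a G)) ^ (K.card - G.card - 1) * ∏ t ∈ G, (α + asum a G - l t)) +
      z ^ K.card * ∏ t ∈ K, (α + asum a K - l t) = ∏ t ∈ K, (1 - z * l t) := by
  have h := Ur_eq_prod z a l K α
  unfold Ur Fr topr at h
  rw [Finset.mul_sum, ← Finset.sum_erase_add _ _ (Finset.mem_powerset_self K), Nat.sub_self, Nat.zero_sub, pow_zero,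
    mul_one] at h
  rw [← h]
  ring

/-! ### §3 The U-RPM corollaries (ARCH-G52 §3.2, every width) -/

/-- **the closed-form weight** of the component `E` (`R` = the compound's sibling set, `c` = mass shares, `s_E = c(E)`):
`w_R = q₁^{|R|-1}`, `w_E = q₁^{|E|-1}(1 − q₁)·s_E^{|E|}·(1 − q₁ s_E)^{|R|-|E|-1}` otherwise. [this work] -/
def urpmW [DecidableEq ι] (q₁ : ℝ) (c : ι → ℝ) (R E : Finset ι) : ℝ :=
  if E = R then q₁ ^ (R.card - 1)
  else q₁ ^ (E.card - 1) * (1 - q₁) * (asum c E) ^ E.card * (1 - q₁ * asum c E) ^ (R.card - E.card - 1)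

/-- the reduced weight `ŵ_E = w_E / s_E^{|E|}` (with `s_R = 1`): `q₁^{|R|-1}` at `E = R`,
`q₁^{|E|-1}(1 − q₁)(1 − q₁ s_E)^{|R|-|E|-1}` otherwise. [this work] -/
def urpmWr [DecidableEq ι] (q₁ : ℝ) (c : ι → ℝ) (R E : Finset ι) : ℝ :=
  if E = R then q₁ ^ (R.card - 1) else q₁ ^ (E.card - 1) * (1 - q₁) * (1 - q₁ * asum c E) ^ (R.card - E.card - 1)

/-- `w_E = ŵ_E · s_E^{|E|}` when the shares sum to `1` on `R`. [this work] -/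
theorem urpmW_eq [DecidableEq ι] (q₁ : ℝ) (c : ι → ℝ) (R E : Finset ι) (hc : asum c R = 1) :
    urpmW q₁ c R E = urpmWr q₁ c R E * (asum c E) ^ E.card := by
  unfold urpmW urpmWr
  split_ifs with h
  · rw [h, hc, one_pow, mul_one]
  · ring

/-- **the weights are nonnegative** (`0 ≤ q₁ ≤ 1`, `0 ≤ s_E`, `q₁ s_E ≤ 1`). [this work] -/
theorem urpmW_nonneg [DecidableEq ι] (q₁ : ℝ) (c : ι → ℝ) (R E : Finset ι) (hq0 : 0 ≤ q₁) (hq1 : q₁ ≤ 1) (hs0 : 0 ≤ asum c E)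
    (hs1 : q₁ * asum c E ≤ 1) : 0 ≤ urpmW q₁ c R E := by
  unfold urpmW
  split_ifs
  · exact pow_nonneg hq0 _
  · exact mul_nonneg (mul_nonneg (mul_nonneg (pow_nonneg hq0 _) (by linarith)) (pow_nonneg hs0 _)) (pow_nonneg (by linarith) _)

/-- **the box condition**: the openness `l_t/s_E ≤ 1` of every member of every component follows from `l_t ≤ c_t` for all `t`
(i.e. `m* ≤ m_t`, as `c_t = l_t m_t/m*`) and `c ≥ 0`. [this work] -/
theorem urpm_box [DecidableEq ι] (c l : ι → ℝ) (E : Finset ι) (hc0 : ∀ t ∈ E, 0 ≤ c t) (hl : ∀ t ∈ E, l t ≤ c t) {t : ι} (ht : t ∈ E)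
    (hpos : 0 < asum c E) : l t / asum c E ≤ 1 := by
  rw [div_le_one hpos]
  exact (hl t ht).trans (Finset.single_le_sum hc0 ht)

/-- **U-RPM, EVERY NONEMPTY PATTERN.**  Shares `c` with `Σ_{t∈R} c_t = 1`, marginals `l`, `∅ ≠ A ⊆ R`; components `E = A ∪ G`,
`G ⊆ R∖A`, `s_E = c(A) + c(G)`: `Σ_G ŵ_{A∪G}·Π_{t∈A} l_t·Π_{t∈G}(s_{A∪G} − l_t) = q₁^{|A|-1} Π_{t∈A} l_t · Π_{t∈R∖A}(1 − q₁ l_t) = ν(A)`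
— i.e. `Σ_{E⊇A} w_E·P_E(exactly A open) = ν(A)` with `P_E(A) = Π_{t∈A}(l_t/s_E) Π_{t∈E∖A}(1 − l_t/s_E)`, written division-free.
[this work] -/
theorem urpm_pattern [DecidableEq ι] (q₁ : ℝ) (c l : ι → ℝ) (R A : Finset ι) (hAR : A ⊆ R) (hA : A.Nonempty) (hc : asum c R = 1) :
    ∑ G ∈ (R \ A).powerset, urpmWr q₁ c R (A ∪ G) * ((∏ t ∈ A, l t) * ∏ t ∈ G, (asum c A + asum c G - l t)) =
      q₁ ^ (A.card - 1) * (∏ t ∈ A, l t) * ∏ t ∈ R \ A, (1 - q₁ * l t) := by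
  have h := hurwitz_gen q₁ c l (R \ A) (asum c A)
  have hdisj : ∀ G, G ⊆ R \ A → Disjoint A G := fun G hG => Finset.disjoint_of_subset_right hG Finset.disjoint_sdiff
  have hsR : asum c A + asum c (R \ A) = 1 := by
    rw [← hc]; unfold asum; rw [← Finset.sum_union Finset.disjoint_sdiff, Finset.union_sdiff_of_subset hAR]
  have hcardR : (R \ A).card = R.card - A.card := by rw [Finset.card_sdiff, Finset.inter_eq_left.2 hAR]
  have hAcard : 0 < A.card := Finset.card_pos.2 hA
  have hAle : A.card ≤ R.card := Finset.card_le_card hAR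
  rw [hsR] at h
  rw [← Finset.sum_erase_add _ _ (Finset.mem_powerset_self (R \ A))]
  have hU : ∀ G, G ⊆ R \ A → asum c (A ∪ G) = asum c A + asum c G := fun G hG => by
    unfold asum; rw [Finset.sum_union (hdisj G hG)]
  have htop : urpmWr q₁ c R (A ∪ (R \ A)) = q₁ ^ (R.card - 1) := by
    unfold urpmWr; rw [if_pos (Finset.union_sdiff_of_subset hAR)]
  have hin : ∀ G ∈ ((R \ A).powerset).erase (R \ A), urpmWr q₁ c R (A ∪ G) =
      q₁ ^ (A.card + G.card - 1) * (1 - q₁) * (1 - q₁ * (asum c A + asum c G)) ^ ((R \ A).card - G.card - 1) := by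
    intro G hG
    have hG' : G ⊆ R \ A := Finset.mem_powerset.1 (Finset.mem_of_mem_erase hG)
    have hne : G ≠ R \ A := Finset.ne_of_mem_erase hG
    have hAG : A ∪ G ≠ R := by
      intro hh
      apply hne
      rw [← hh, Finset.union_sdiff_left, Finset.sdiff_eq_self_of_disjoint (hdisj G hG').symm]
    unfold urpmWr
    rw [if_neg hAG, Finset.card_union_of_disjoint (hdisj G hG'), hU G hG', hcardR]
    congr 2
    omega
  rw [htop, Finset.sum_congr rfl fun G hG => by rw [hin G hG]]
  have hsplit : ∀ G ∈ ((R \ A).powerset).erase (R \ A),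
      q₁ ^ (A.card + G.card - 1) * (1 - q₁) * (1 - q₁ * (asum c A + asum c G)) ^ ((R \ A).card - G.card - 1) *
        ((∏ t ∈ A, l t) * ∏ t ∈ G, (asum c A + asum c G - l t)) =
      q₁ ^ (A.card - 1) * (∏ t ∈ A, l t) * ((1 - q₁ * 1) *
        (q₁ ^ G.card * (1 - q₁ * (asum c A + asum c G)) ^ ((R \ A).card - G.card - 1) * ∏ t ∈ G, (asum c A + asum c G - l t))) := by
    intro G _
    rw [show A.card + G.card - 1 = (A.card - 1) + G.card by omega, pow_add]
    ring
  rw [Finset.sum_congr rfl hsplit, ← Finset.mul_sum]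
  have e2 : ∏ t ∈ R \ A, (asum c A + asum c (R \ A) - l t) = ∏ t ∈ R \ A, (1 - l t) :=
    Finset.prod_congr rfl fun t _ => by rw [hsR]
  rw [hcardR] at h ⊢
  rw [e2]
  have e3 : q₁ ^ (R.card - 1) = q₁ ^ (A.card - 1) * q₁ ^ (R.card - A.card) := by
    rw [← pow_add]; congr 1; omega
  rw [e3, ← h]
  ring

/-- **U-RPM, THE EMPTY PATTERN** (`R ≠ ∅`): `q₁·Σ_{∅≠E⊆R} ŵ_E·Π_{t∈E}(s_E − l_t) = Π_{t∈R}(1 − q₁ l_t) − (1 − q₁) = q₁·ν(∅)`. [this work] -/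
theorem urpm_empty [DecidableEq ι] (q₁ : ℝ) (c l : ι → ℝ) (R : Finset ι) (hR : R.Nonempty) (hc : asum c R = 1) :
    q₁ * ∑ E ∈ R.powerset.erase ∅, urpmWr q₁ c R E * ∏ t ∈ E, (asum c E - l t) =
      (∏ t ∈ R, (1 - q₁ * l t)) - (1 - q₁) := by
  have h := hurwitz_gen q₁ c l R 0
  simp only [zero_add, hc, mul_one] at h
  have hRne : R ≠ ∅ := Finset.nonempty_iff_ne_empty.1 hR
  have hcard : 0 < R.card := Finset.card_pos.2 hR
  -- split `∅` off the strict-subset sum of `h` and `R` off the goal's sum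
  rw [← Finset.sum_erase_add _ _ (Finset.mem_erase.2 ⟨Ne.symm hRne, Finset.empty_mem_powerset R⟩)] at h
  rw [← Finset.sum_erase_add _ _ (Finset.mem_erase.2 ⟨hRne, Finset.mem_powerset_self R⟩)]
  rw [Finset.erase_right_comm]
  have h0 : asum c (∅ : Finset ι) = 0 := Finset.sum_empty
  simp only [Finset.card_empty, pow_zero, h0, mul_zero, sub_zero, one_pow, Finset.prod_empty, mul_one, Nat.sub_zero] at h
  have hin : ∀ E ∈ (R.powerset.erase R).erase ∅, q₁ * (urpmWr q₁ c R E * ∏ t ∈ E, (asum c E - l t)) =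
      (1 - q₁) * (q₁ ^ E.card * (1 - q₁ * asum c E) ^ (R.card - E.card - 1) * ∏ t ∈ E, (asum c E - l t)) := by
    intro E hE
    have hE1 : E ≠ ∅ := Finset.ne_of_mem_erase hE
    have hE2 : E ≠ R := Finset.ne_of_mem_erase (Finset.mem_of_mem_erase hE)
    have hEc : 0 < E.card := Finset.card_pos.2 (Finset.nonempty_iff_ne_empty.2 hE1)
    unfold urpmWr
    rw [if_neg hE2, show E.card = E.card - 1 + 1 from (Nat.sub_add_cancel hEc).symm, pow_succ]
    rw [Nat.add_sub_cancel]
    ring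
  have htop : urpmWr q₁ c R R = q₁ ^ (R.card - 1) := by unfold urpmWr; rw [if_pos rfl]
  rw [mul_add, Finset.mul_sum, Finset.sum_congr rfl hin, htop, hc]
  rw [show q₁ * (q₁ ^ (R.card - 1) * ∏ t ∈ R, (1 - l t)) = q₁ ^ R.card * ∏ t ∈ R, (1 - l t) by
    rw [← mul_assoc, ← pow_succ', Nat.sub_add_cancel hcard]]
  linarith

/-- **TOTAL WEIGHT ONE**: `Σ_{∅≠E⊆R} w_E = 1` (`R ≠ ∅`, shares summing to `1`, `q₁ ≠ 0`) — (★) with `l ≡ 0`. [this work] -/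
theorem urpm_total [DecidableEq ι] (q₁ : ℝ) (c : ι → ℝ) (R : Finset ι) (hR : R.Nonempty) (hc : asum c R = 1) (hq : q₁ ≠ 0) :
    ∑ E ∈ R.powerset.erase ∅, urpmW q₁ c R E = 1 := by
  have h := urpm_empty q₁ c (fun _ => (0 : ℝ)) R hR hc
  simp only [sub_zero, mul_zero, Finset.prod_const_one] at h
  have h2 : ∑ E ∈ R.powerset.erase ∅, urpmW q₁ c R E = ∑ E ∈ R.powerset.erase ∅, urpmWr q₁ c R E * ∏ t ∈ E, asum c E := by
    refine Finset.sum_congr rfl fun E _ => ?_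
    rw [urpmW_eq q₁ c R E hc, Finset.prod_const]
  rw [h2]
  have h3 : q₁ * ∑ E ∈ R.powerset.erase ∅, urpmWr q₁ c R E * ∏ t ∈ E, asum c E = q₁ * 1 := by rw [h]; ring
  exact mul_left_cancel₀ hq h3

end URPM
end Quant
end Summit.CriticalPhenomena.PercolationContinuityZ3.Theorems
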